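import Literature.AlgebraicGeometry.HodgeTheory.AbelianVarietyCyclotomicAutomorphismIsogenyClass
import Literature.AlgebraicGeometry.HodgeTheory.AbelianVarietyCyclotomicAutomorphismMultiplicities
import HarnessLib

/-!
# Prime level: the single trace `τ = Tr_a(δ) = Σ_{j=1}^{p−1} a_j ζ_p^j` determines the whole multiplicity function
# (`ζ_p, …, ζ_p^{p−1}` are linearly independent over `ℚ`), hence the CM type, the analytic character, the dimension,
# and — at the CM level `p − 1 = 2 dim` — the equivariant isogeny class (Zarhin, Lemma 1.9; Shimura, Cor. of Thm. 2)

Family `hodge`, lane `lit-hodgefound` (seat p03, GEN 36 «Hodge classes from the analytic type of a cyclotomic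
automorphism»), topic `Literature/AlgebraicGeometry/HodgeTheory`.  Theorems only: no definition, no instance, no named
fact (net Literature debt 0).  Junction BY NAME of GEN 35's Lemma 1.9 (`trace_lieMap_eq_sum_Ico_of_prime`:
`Tr_a(δ) = Σ_{j=1}^{p−1} n_{ζ^j}(δ) ζ^j` for `Φ_p(δ) = 0`) with Mathlib's `cyclotomic_eq_minpoly_rat` (`Φ_p` is the minimal
polynomial of `ζ_p` over `ℚ`, of degree `p − 1`) and GEN 36's `…IsogenyClass` (multiplicities ⟺ CM type ⟺ character ⟺
equivariant isogeny class at the CM level).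

## Sources, verbatim (held text `paper:arxiv-2109.06794`)

Yu. G. Zarhin, *Jacobians with automorphisms of prime order*, arXiv:2109.06794, §1 Lemma 1.9 (chunk p0004 L55–L60):
«Let `φ^* : Ω¹(𝒞) → Ω¹(𝒞)` be the automorphism of the `g`-dimensional complex vector space `Ω¹(𝒞)` induced by `φ` and
`τ` the trace of `φ^*`. Then `τ = Σ_{j=1}^{p-1} a_j ζ_p^j = Σ_{h ∈ G} 𝐚(h) ζ_p^h`»; §1 (chunk p0003 L35–L47): «`ℚ(ζ_p) ⊗_ℚ ℂ =
⊕_{j=1}^{p-1} ℂ` where the `j`th summand corresponds to the field embedding that sends `ζ_p` to `ζ_p^j` […] all `a_j` are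
non-negative integers and `Σ_{j=1}^{p-1} a_j = g`».  Since `1 + ζ_p + ⋯ + ζ_p^{p−1} = 0` is the only relation, the
`p − 1` numbers `ζ_p, …, ζ_p^{p−1}` form a `ℚ`-basis of `ℚ(ζ_p)`, so `τ` DETERMINES `(a_1, …, a_{p−1})`.

G. Shimura, *Abelian Varieties with Complex Multiplication and Modular Functions* (1998), §8.2 (chunk p0081 L1–L3): «any
two abelian varieties of the same CM-type are isogenous to each other».

## What is proved (namespace `Literature.AlgebraicGeometry.HodgeTheory.AbelianVariety`)

* §1 (algebra) **`eq_of_sum_Ico_natCast_mul_pow_eq`**: for a prime `p`, a primitive `p`-th root `ζ ∈ ℂ` and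
  `a, b : ℕ → ℕ`, `Σ_{j=1}^{p−1} a_j ζ^j = Σ_{j=1}^{p−1} b_j ζ^j ⟹ a_j = b_j` for `1 ≤ j < p`.
* §2 (`Φ_p(δ_A) = 0 = Φ_p(δ_B)`, any dimensions) **`eigenMultiplicity_eq_of_trace_eq_of_prime`** (`Tr_a(δ_A) = Tr_a(δ_B) ⟹
  n_ζ(δ_A) = n_ζ(δ_B)` for every `ζ`), `dim_eq_of_trace_eq_of_prime`, **`cmTypeOf_eq_of_trace_eq_of_prime`**,
  `forall_trace_pow_eq_of_trace_eq_of_prime` (the whole character from `τ`).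
* §3 (CM level `p − 1 = 2 dim A = 2 dim B`) **`exists_isIsogeny_comm_iff_trace_eq_of_prime`** (`(A, δ_A)`, `(B, δ_B)` are
  equivariantly isogenous iff `Tr_a(δ_A) = Tr_a(δ_B)`), `isIsogenous_of_trace_eq_of_prime`.

## References

* [Zarhin2021PrimeOrderJacobians] Yu. G. Zarhin, arXiv:2109.06794, §1 Lemma 1.9 (chunk p0004), §1 (chunk p0003).
* [Shimura1998] G. Shimura, *Abelian Varieties with Complex Multiplication and Modular Functions* (1998), §8.2 (chunk p0081),
  §6.1 Thm. 2 Corollary.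
* [Washington1997] L. C. Washington, *Introduction to Cyclotomic Fields*, Ch. 2 (`[ℚ(ζ_p) : ℚ] = p − 1`, `Φ_p` irreducible).
-/

noncomputable section

open CategoryTheory Module Polynomial

namespace Literature.AlgebraicGeometry.HodgeTheory

namespace AbelianVariety

open Literature.AlgebraicTopology.SingularHomology
open Literature.AlgebraicGeometry.Motives.AbelianVariety (Lie lieMap lieMapRingHom IsIsogeny)

/-! ## §1 `ζ, ζ², …, ζ^{p−1}` are linearly independent over `ℚ` -/

section Algebra

variable {p : ℕ} [hp : Fact p.Prime]

/-- **A rational relation `Σ_{j=1}^{p−1} c_j ζ^j = 0` among the non-trivial powers of a primitive `p`-th root of unity is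
trivial**: the polynomial `Σ_j c_j X^{j−1}` of degree `< p − 1 = deg Φ_p` vanishes at `ζ`, and `Φ_p = minpoly_ℚ(ζ)`.
[cite: Washington1997, Ch. 2 (Φ_p irreducible of degree p − 1)] [cite: Zarhin2021PrimeOrderJacobians, §1 Lemma 1.9 (chunk p0004 L55–L60)] -/
theorem eq_zero_of_sum_range_ratCast_mul_pow_succ_eq_zero {ζ : ℂ} (hζ : IsPrimitiveRoot ζ p) (c : ℕ → ℚ)
    (h : ∑ i ∈ Finset.range (p - 1), (c i : ℂ) * ζ ^ (i + 1) = 0) : ∀ i < p - 1, c i = 0 := by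
  have hp1 : 1 < p := hp.out.one_lt
  -- the polynomial `Q = Σ_{i < p-1} c_i X^i`, with `ζ · Q(ζ) = Σ c_i ζ^{i+1} = 0`
  set Q : ℚ[X] := ∑ i ∈ Finset.range (p - 1), C (c i) * X ^ i with hQ
  have hζ0 : ζ ≠ 0 := hζ.ne_zero (by omega)
  have haeval : aeval ζ Q = 0 := by
    have h1 : ζ * aeval ζ Q = ∑ i ∈ Finset.range (p - 1), (c i : ℂ) * ζ ^ (i + 1) := by
      rw [hQ, map_sum, Finset.mul_sum]
      refine Finset.sum_congr rfl fun i _ ↦ ?_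
      rw [map_mul, aeval_C, map_pow, aeval_X, pow_succ, eq_ratCast]
      ring
    rw [h] at h1
    exact (mul_eq_zero.1 h1).resolve_left hζ0
  -- `minpoly_ℚ(ζ) = Φ_p` divides `Q`, of smaller degree: `Q = 0`
  have hdvd : cyclotomic p ℚ ∣ Q := by
    rw [cyclotomic_eq_minpoly_rat hζ hp.out.pos]
    exact minpoly.dvd ℚ ζ haeval
  have hQ0 : Q = 0 := by
    refine eq_zero_of_dvd_of_degree_lt hdvd ?_
    rw [degree_cyclotomic, Nat.totient_prime hp.out]
    refine lt_of_le_of_lt (degree_sum_le _ _) ?_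
    refine (Finset.sup_lt_iff (by exact WithBot.bot_lt_coe _)).2 fun i hi ↦ ?_
    exact lt_of_le_of_lt (degree_C_mul_X_pow_le i (c i)) (by exact_mod_cast Finset.mem_range.1 hi)
  -- read off the coefficients
  intro i hi
  have hcoeff : Q.coeff i = c i := by
    rw [hQ, finsetSum_coeff, Finset.sum_eq_single i]
    · rw [coeff_C_mul, coeff_X_pow, if_pos rfl, mul_one]
    · intro j _ hji
      rw [coeff_C_mul, coeff_X_pow, if_neg (Ne.symm hji), mul_zero]
    · intro hi'
      exact absurd (Finset.mem_range.2 hi) hi'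
  rw [← hcoeff, hQ0, coeff_zero]

/-- **`Σ_{j=1}^{p−1} a_j ζ^j = Σ_{j=1}^{p−1} b_j ζ^j` with natural coefficients forces `a_j = b_j`** (`1 ≤ j < p`):
`ζ, …, ζ^{p−1}` is a `ℚ`-basis of `ℚ(ζ_p)`. [cite: Zarhin2021PrimeOrderJacobians, §1 Lemma 1.9 (chunk p0004 L55–L60)]
[cite: Washington1997, Ch. 2] -/
theorem eq_of_sum_Ico_natCast_mul_pow_eq {ζ : ℂ} (hζ : IsPrimitiveRoot ζ p) (a b : ℕ → ℕ)
    (h : ∑ j ∈ Finset.Ico 1 p, (a j : ℂ) * ζ ^ j = ∑ j ∈ Finset.Ico 1 p, (b j : ℂ) * ζ ^ j) :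
    ∀ j ∈ Finset.Ico 1 p, a j = b j := by
  have key := eq_zero_of_sum_range_ratCast_mul_pow_succ_eq_zero hζ (fun i ↦ (a (i + 1) : ℚ) - b (i + 1)) (by
    have hA := Finset.sum_Ico_eq_sum_range (fun j ↦ (a j : ℂ) * ζ ^ j) 1 p
    have hB := Finset.sum_Ico_eq_sum_range (fun j ↦ (b j : ℂ) * ζ ^ j) 1 p
    rw [hA, hB] at h
    have : ∑ i ∈ Finset.range (p - 1), (((a (i + 1) : ℚ) - b (i + 1) : ℚ) : ℂ) * ζ ^ (i + 1) =
        ∑ i ∈ Finset.range (p - 1), (a (1 + i) : ℂ) * ζ ^ (1 + i) -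
          ∑ i ∈ Finset.range (p - 1), (b (1 + i) : ℂ) * ζ ^ (1 + i) := by
      rw [← Finset.sum_sub_distrib]
      refine Finset.sum_congr rfl fun i _ ↦ ?_
      rw [add_comm 1 i]; push_cast; ring
    rw [this, h, sub_self])
  intro j hj
  obtain ⟨hj1, hjp⟩ := Finset.mem_Ico.1 hj
  have hk := key (j - 1) (by omega)
  rw [Nat.sub_add_cancel hj1, sub_eq_zero] at hk
  exact_mod_cast hk

end Algebra

/-! ## §2 The trace determines the multiplicity function, the dimension, the CM type and the character -/

section Trace

variable {A B : Motives.AbelianVariety ℂ} {δA : A ⟶ A} {δB : B ⟶ B} {p : ℕ} [hp : Fact p.Prime]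

/-- **`Tr_a(δ_A) = Tr_a(δ_B)` ⟹ `n_ζ(δ_A) = n_ζ(δ_B)` for every `ζ`** (`Φ_p(δ_A) = 0 = Φ_p(δ_B)`; no dimension hypothesis):
«`τ = Σ_{j=1}^{p-1} a_j ζ_p^j`» on both sides and §1. [cite: Zarhin2021PrimeOrderJacobians, §1 Lemma 1.9 (chunk p0004 L55–L60)] -/
theorem eigenMultiplicity_eq_of_trace_eq_of_prime
    (hδA : (cyclotomic p ℤ).eval₂ (Int.castRingHom (End A)) (End.of δA) = 0)
    (hδB : (cyclotomic p ℤ).eval₂ (Int.castRingHom (End B)) (End.of δB) = 0)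
    (h : LinearMap.trace ℂ (Lie A) (lieMap A δA) = LinearMap.trace ℂ (Lie B) (lieMap B δB)) (ζ : ℂ) :
    eigenMultiplicity A δA ζ = eigenMultiplicity B δB ζ := by
  have hp0 : 0 < p := hp.out.pos
  by_cases hζ : IsPrimitiveRoot ζ p
  · -- `ζ = ζ₀^j` for the standard primitive root `ζ₀` and some `1 ≤ j < p`
    have hζ₀ : IsPrimitiveRoot (Complex.exp (2 * Real.pi * Complex.I / p)) p := Complex.isPrimitiveRoot_exp p hp0.ne'
    obtain ⟨j, hjp, rfl⟩ := hζ₀.eq_pow_of_pow_eq_one hζ.pow_eq_one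
    have hj1 : 1 ≤ j := by
      rcases Nat.eq_zero_or_pos j with h0 | h0
      · subst h0
        rw [pow_zero] at hζ
        exact absurd rfl (hζ.ne_one hp.out.one_lt)
      · exact h0
    rw [trace_lieMap_eq_sum_Ico_of_prime hδA hζ₀, trace_lieMap_eq_sum_Ico_of_prime hδB hζ₀] at h
    exact eq_of_sum_Ico_natCast_mul_pow_eq hζ₀ _ _ h j (Finset.mem_Ico.2 ⟨hj1, hjp⟩)
  · rw [eigenMultiplicity_eq_zero_of_not_isPrimitiveRoot hp0 hδA hζ,
      eigenMultiplicity_eq_zero_of_not_isPrimitiveRoot hp0 hδB hζ]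

/-- **The trace determines the dimension**: `Tr_a(δ_A) = Tr_a(δ_B) ⟹ dim A = dim B` («`Σ_{j=1}^{p-1} a_j = g`»).
[cite: Zarhin2021PrimeOrderJacobians, §1 (1.2) and Lemma 1.9 (chunks p0003 L42–L47, p0004 L55–L60)] -/
theorem dim_eq_of_trace_eq_of_prime
    (hδA : (cyclotomic p ℤ).eval₂ (Int.castRingHom (End A)) (End.of δA) = 0)
    (hδB : (cyclotomic p ℤ).eval₂ (Int.castRingHom (End B)) (End.of δB) = 0)
    (h : LinearMap.trace ℂ (Lie A) (lieMap A δA) = LinearMap.trace ℂ (Lie B) (lieMap B δB)) : A.dim = B.dim := by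
  rw [← sum_eigenMultiplicity_primitiveRoots_eq_dim hp.out.pos hδA,
    ← sum_eigenMultiplicity_primitiveRoots_eq_dim hp.out.pos hδB]
  exact Finset.sum_congr rfl fun ζ _ ↦ eigenMultiplicity_eq_of_trace_eq_of_prime hδA hδB h ζ

/-- **The trace determines the CM type**: `Tr_a(δ_A) = Tr_a(δ_B) ⟹ cmTypeOf A δ_A p = cmTypeOf B δ_B p`.
[cite: Zarhin2021PrimeOrderJacobians, §1 Lemma 1.9 (chunk p0004 L55–L60)] [cite: Shimura1998, §5.2 (chunk p0051)] -/
theorem cmTypeOf_eq_of_trace_eq_of_prime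
    (hδA : (cyclotomic p ℤ).eval₂ (Int.castRingHom (End A)) (End.of δA) = 0)
    (hδB : (cyclotomic p ℤ).eval₂ (Int.castRingHom (End B)) (End.of δB) = 0)
    (h : LinearMap.trace ℂ (Lie A) (lieMap A δA) = LinearMap.trace ℂ (Lie B) (lieMap B δB)) :
    cmTypeOf A δA p = cmTypeOf B δB p :=
  cmTypeOf_eq_of_forall_eigenMultiplicity_eq (eigenMultiplicity_eq_of_trace_eq_of_prime hδA hδB h) p

/-- **The trace determines the whole analytic character**: `Tr_a(δ_A) = Tr_a(δ_B) ⟹ Tr_a(δ_A^k) = Tr_a(δ_B^k)` for all `k`.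
[cite: Zarhin2021PrimeOrderJacobians, §1 Lemma 1.9 (chunk p0004 L55–L60)] -/
theorem forall_trace_pow_eq_of_trace_eq_of_prime
    (hδA : (cyclotomic p ℤ).eval₂ (Int.castRingHom (End A)) (End.of δA) = 0)
    (hδB : (cyclotomic p ℤ).eval₂ (Int.castRingHom (End B)) (End.of δB) = 0)
    (h : LinearMap.trace ℂ (Lie A) (lieMap A δA) = LinearMap.trace ℂ (Lie B) (lieMap B δB)) (k : ℕ) :
    LinearMap.trace ℂ (Lie A) (lieMapRingHom A (End.of δA ^ k)) =
      LinearMap.trace ℂ (Lie B) (lieMapRingHom B (End.of δB ^ k)) :=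
  (forall_eigenMultiplicity_eq_iff_forall_trace_pow_eq hp.out.pos (pow_eq_one_of_cyclotomic hδA)
    (pow_eq_one_of_cyclotomic hδB)).1 (eigenMultiplicity_eq_of_trace_eq_of_prime hδA hδB h) k

end Trace

/-! ## §3 The CM level `p − 1 = 2 dim`: the trace determines the equivariant isogeny class -/

section CMLevel

variable {A B : Motives.AbelianVariety ℂ} {δA : A ⟶ A} {δB : B ⟶ B} {p : ℕ} [hp : Fact p.Prime]

/-- **`(A, δ_A)` and `(B, δ_B)` (`Φ_p = 0`, CM level `p − 1 = 2 dim`) are EQUIVARIANTLY ISOGENOUS iff `Tr_a(δ_A) = Tr_a(δ_B)`**: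
«⟹» the trace is an isogeny invariant; «⟸» the trace determines the CM type (§2) and Shimura's Corollary
(`…IsogenyClass`). [cite: Zarhin2021PrimeOrderJacobians, §1 Lemma 1.9 (chunk p0004 L55–L60)] [cite: Shimura1998, §8.2 (chunk p0081 L1–L3)] -/
theorem exists_isIsogeny_comm_iff_trace_eq_of_prime
    (hδA : (cyclotomic p ℤ).eval₂ (Int.castRingHom (End A)) (End.of δA) = 0)
    (hδB : (cyclotomic p ℤ).eval₂ (Int.castRingHom (End B)) (End.of δB) = 0)
    (hgA : Nat.totient p = 2 * A.dim) (hgB : Nat.totient p = 2 * B.dim) :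
    (∃ f : A ⟶ B, IsIsogeny f ∧ f ≫ δB = δA ≫ f) ↔
      LinearMap.trace ℂ (Lie A) (lieMap A δA) = LinearMap.trace ℂ (Lie B) (lieMap B δB) := by
  haveI : NeZero p := ⟨hp.out.ne_zero⟩
  constructor
  · rintro ⟨f, hfi, hf⟩
    exact Motives.AbelianVariety.trace_lieMap_eq_of_isIsogeny hfi hf.symm
  · intro h
    exact (exists_isIsogeny_comm_iff_cmTypeOf_eq hδA hδB hgA hgB).2 (cmTypeOf_eq_of_trace_eq_of_prime hδA hδB h)

/-- **Same trace ⟹ isogenous** (CM level). [cite: Shimura1998, §8.2 (chunk p0081 L1–L3)] [cite: Zarhin2021PrimeOrderJacobians, §1 Lemma 1.9 (chunk p0004 L55–L60)] -/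
theorem isIsogenous_of_trace_eq_of_prime
    (hδA : (cyclotomic p ℤ).eval₂ (Int.castRingHom (End A)) (End.of δA) = 0)
    (hδB : (cyclotomic p ℤ).eval₂ (Int.castRingHom (End B)) (End.of δB) = 0)
    (hgA : Nat.totient p = 2 * A.dim) (hgB : Nat.totient p = 2 * B.dim)
    (h : LinearMap.trace ℂ (Lie A) (lieMap A δA) = LinearMap.trace ℂ (Lie B) (lieMap B δB)) : A.IsIsogenous B := by
  obtain ⟨f, hfi, -⟩ := (exists_isIsogeny_comm_iff_trace_eq_of_prime hδA hδB hgA hgB).2 h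
  exact ⟨f, hfi⟩

end CMLevel

end AbelianVariety

end Literature.AlgebraicGeometry.HodgeTheory

end
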